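import Literature.Algebra.Homology.HomologyEulerCharacteristicShortExact
import Literature.Algebra.Homology.EulerCharacteristicMappingCone
import Mathlib.Algebra.Homology.HomotopyCategory.Pretriangulated
import HarnessLib

/-!
# `χ_H` is additive on distinguished triangles of the homotopy category `K(Vect_k)`

Layer `Literature/Algebra/Homology` (pure homological algebra over Mathlib; proved theorems only, 0 definitions, 0 named facts,
no instances, no notation). For a division ring `K` and Mathlib's pretriangulated homotopy category
`HomotopyCategory (ModuleCat K) (ComplexShape.up ℤ)` (objects `X` with underlying cochain complex `X.as`), Mathlib's
`HomologicalComplex.homologyEulerChar` satisfies: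

* `moduleFinite_homology_of_quasiIso`, `finrankSupport_homology_eq_of_quasiIso` — transport of the finiteness hypotheses
  along a quasi-isomorphism (`isoOfQuasiIsoAt`);
* `homologyEulerChar_eq_of_iso` — objects isomorphic in the homotopy category have the same `χ_H` (Mathlib's
  `HomotopyCategory.homotopyEquivOfIso` + row `EulerCharacteristicShortExact`'s `homologyEulerChar_eq_of_quasiIso`);
* **`homologyEulerChar_of_distinguished`** — for `T ∈ distTriang` with `T.obj₁.as`, `T.obj₃.as` having finite-dimensional,
  finitely supported cohomology, **`χ_H(T.obj₂.as) = χ_H(T.obj₁.as) + χ_H(T.obj₃.as)`**: by Mathlib's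
  `HomotopyCategory.distinguished_iff_iso_trianglehOfDegreewiseSplit`, `T` is isomorphic to the triangle of a degreewise split
  short exact sequence `S` of cochain complexes, whose three terms are homotopy equivalent to the `T.objᵢ.as`; `S` is short
  exact (`shortExact_of_degreewise_shortExact`) and row `HomologyEulerCharacteristicShortExact`'s `homologyEulerChar_X₂_eq_add`
  applies (Görtz–Wedhorn II Rem. 23.62 (2): "Let `𝓕' → 𝓕 → 𝓕'' →` be a distinguished triangle … then
  `χ(𝓕) = χ(𝓕') + χ(𝓕'')`").

Mathlib (pin v4.32) has no Euler characteristic on triangulated categories; the tree's `KTheory/*EulerChar*` rows are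
`K₀(Coh X)` statements for schemes (different objects). Library only (cell `pub-hodge-ring2`, count-neutral); proves nothing
about any crux, route or conjecture.

## References

* U. Görtz, T. Wedhorn, *Algebraic Geometry II* (2023), Remark 23.62 (2) with Definition∕Remark 23.59. [GortzWedhorn2023]
* S. Lang, *Algebra* (2002), Ch. XX §3 (Euler–Poincaré maps on `K₀`). [Lang2002]
-/

open CategoryTheory CategoryTheory.Limits CategoryTheory.Pretriangulated

universe v u

namespace Literature.Algebra.Homology.EulerCharTriangle

variable {K : Type u} [DivisionRing K]

/-! ### Transport along quasi-isomorphisms and along isomorphisms of `K(Vect)` -/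

section Transport

variable {ι : Type*} {c : ComplexShape ι} {A B : HomologicalComplex (ModuleCat.{v} K) c}

/-- Finite-dimensionality of cohomology passes along a quasi-isomorphism. [cite: GortzWedhorn2023, Definition 23.59] -/
theorem moduleFinite_homology_of_quasiIso (f : A ⟶ B) [QuasiIso f] (i : ι) [Module.Finite K (A.homology i)] :
    Module.Finite K (B.homology i) :=
  Module.Finite.equiv (isoOfQuasiIsoAt f i).toLinearEquiv

/-- The rank support of cohomology is invariant under quasi-isomorphism. [cite: GortzWedhorn2023, Definition 23.59] -/
theorem finrankSupport_homology_eq_of_quasiIso (f : A ⟶ B) [QuasiIso f] :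
    GradedObject.finrankSupport (fun i => B.homology i) = GradedObject.finrankSupport (fun i => A.homology i) := by
  ext i
  simp only [GradedObject.finrankSupport, Function.mem_support, ne_eq]
  rw [LinearEquiv.finrank_eq (isoOfQuasiIsoAt f i).toLinearEquiv]

end Transport

/-- **Isomorphic objects of the homotopy category have the same `χ_H`.** [cite: GortzWedhorn2023, Definition 23.59] -/
theorem homologyEulerChar_eq_of_iso {ι : Type*} {c : ComplexShape ι} [c.EulerCharSigns]
    {X Y : HomotopyCategory (ModuleCat.{v} K) c} (e : X ≅ Y) :
    X.as.homologyEulerChar = Y.as.homologyEulerChar :=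
  EulerCharShortExact.homologyEulerChar_eq_of_quasiIso
    (HomotopyCategory.homotopyEquivOfIso (C := X.as) (D := Y.as) e).hom

/-! ### Distinguished triangles -/

/-- **`χ_H` is additive on distinguished triangles of `K(Vect_K)`**: for a distinguished triangle `T` of
`HomotopyCategory (ModuleCat K) (up ℤ)` whose outer vertices have finite-dimensional, finitely supported cohomology,
`χ_H(T.obj₂) = χ_H(T.obj₁) + χ_H(T.obj₃)`. [cite: GortzWedhorn2023, Remark 23.62 (2)] [cite: Lang2002, XX §3] -/
theorem homologyEulerChar_of_distinguished (T : Triangle (HomotopyCategory (ModuleCat.{v} K) (ComplexShape.up ℤ)))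
    (hT : T ∈ distTriang _) [∀ i, Module.Finite K (T.obj₁.as.homology i)] [∀ i, Module.Finite K (T.obj₃.as.homology i)]
    (h₁ : (GradedObject.finrankSupport fun i => T.obj₁.as.homology i).Finite)
    (h₃ : (GradedObject.finrankSupport fun i => T.obj₃.as.homology i).Finite) :
    T.obj₂.as.homologyEulerChar = T.obj₁.as.homologyEulerChar + T.obj₃.as.homologyEulerChar := by
  obtain ⟨S, σ, ⟨e⟩⟩ := (HomotopyCategory.distinguished_iff_iso_trianglehOfDegreewiseSplit T).1 hT
  have hS : S.ShortExact := HomologicalComplex.shortExact_of_degreewise_shortExact S fun n => (σ n).shortExact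
  -- the three vertices of `T` are homotopy equivalent to the three terms of `S`
  let e₁ := HomotopyCategory.homotopyEquivOfIso (C := T.obj₁.as) (D := S.X₁) (Triangle.π₁.mapIso e)
  let e₂ := HomotopyCategory.homotopyEquivOfIso (C := T.obj₂.as) (D := S.X₂) (Triangle.π₂.mapIso e)
  let e₃ := HomotopyCategory.homotopyEquivOfIso (C := T.obj₃.as) (D := S.X₃) (Triangle.π₃.mapIso e)
  haveI : ∀ i, Module.Finite K (S.X₁.homology i) := fun i => moduleFinite_homology_of_quasiIso e₁.hom i
  haveI : ∀ i, Module.Finite K (S.X₃.homology i) := fun i => moduleFinite_homology_of_quasiIso e₃.hom i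
  have hs₁ : (GradedObject.finrankSupport fun i => S.X₁.homology i).Finite := by
    rw [finrankSupport_homology_eq_of_quasiIso e₁.hom]; exact h₁
  have hs₃ : (GradedObject.finrankSupport fun i => S.X₃.homology i).Finite := by
    rw [finrankSupport_homology_eq_of_quasiIso e₃.hom]; exact h₃
  rw [EulerCharShortExact.homologyEulerChar_eq_of_quasiIso e₁.hom, EulerCharShortExact.homologyEulerChar_eq_of_quasiIso e₂.hom,
    EulerCharShortExact.homologyEulerChar_eq_of_quasiIso e₃.hom]
  exact EulerCharShortExact.homologyEulerChar_X₂_eq_add hS hs₁ hs₃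

/-- The same additivity read on the third vertex: `χ_H(T.obj₃) = χ_H(T.obj₂) − χ_H(T.obj₁)`.
[cite: GortzWedhorn2023, Remark 23.62 (2)] -/
theorem homologyEulerChar_obj₃_of_distinguished (T : Triangle (HomotopyCategory (ModuleCat.{v} K) (ComplexShape.up ℤ)))
    (hT : T ∈ distTriang _) [∀ i, Module.Finite K (T.obj₁.as.homology i)] [∀ i, Module.Finite K (T.obj₃.as.homology i)]
    (h₁ : (GradedObject.finrankSupport fun i => T.obj₁.as.homology i).Finite)
    (h₃ : (GradedObject.finrankSupport fun i => T.obj₃.as.homology i).Finite) :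
    T.obj₃.as.homologyEulerChar = T.obj₂.as.homologyEulerChar - T.obj₁.as.homologyEulerChar := by
  rw [homologyEulerChar_of_distinguished T hT h₁ h₃]
  ring

/-- **A degreewise split short exact sequence of cochain complexes gives `χ_H(X₂) = χ_H(X₁) + χ_H(X₃)`** (the case
`T = trianglehOfDegreewiseSplit S σ`). [cite: GortzWedhorn2023, Remark 23.62 (2)] -/
theorem homologyEulerChar_of_degreewiseSplit (S : ShortComplex (CochainComplex (ModuleCat.{v} K) ℤ))
    (σ : ∀ n, (S.map (HomologicalComplex.eval _ _ n)).Splitting)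
    [∀ i, Module.Finite K (S.X₁.homology i)] [∀ i, Module.Finite K (S.X₃.homology i)]
    (h₁ : (GradedObject.finrankSupport fun i => S.X₁.homology i).Finite)
    (h₃ : (GradedObject.finrankSupport fun i => S.X₃.homology i).Finite) :
    S.X₂.homologyEulerChar = S.X₁.homologyEulerChar + S.X₃.homologyEulerChar :=
  EulerCharShortExact.homologyEulerChar_X₂_eq_add
    (HomologicalComplex.shortExact_of_degreewise_shortExact S fun n => (σ n).shortExact) h₁ h₃

end Literature.Algebra.Homology.EulerCharTriangle
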